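import Summits.CriticalPhenomena.PercolationContinuityZ3.Theorems.PercNearOneGluingNoHeavyLowerTailSahiTriangleSupermodular
import Summits.CriticalPhenomena.PercolationContinuityZ3.Theorems.PercNearOneGluingNoHeavyLowerTailSahiTriangleStaircaseAllDominance
import Mathlib.Tactic.Linarith
import Mathlib.Tactic.Ring
import Mathlib.Tactic.FieldSimp
import Mathlib.Tactic.LinearCombination
import HarnessLib

/-!
# `NoHeavyLowerTail` (crux stmt-CriticalPhenomena-4575), P2 — **CONJECTURE STAIR IS A THEOREM: the `K`-step staircase member, every `K`**

Memo SAHI-ROUTE.md §4.26 (seat `prim-masterthm-p2`, gen 8; `--supports stmt-CriticalPhenomena-4575`).  No `sorry`, no named facts.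
Contains `…SahiTriangleSupermodular` (`K = 1`), `…Submodular`, `…Staircase`, `…StaircaseTwoFull` (`K = 2`) as special cases.

SETTING (class T).  Finite distributive lattices `α, β, γ` with FKG probability weights `wA, wB, wC`; `g : γ → β → ℝ`,
`h : α → β → ℝ` nonnegative coordinatewise monotone (ARBITRARY); the third member is a `K`-STEP STAIRCASE across its two blocks,
`f(c,a) = Σ_{l<K+1} (φ_{l+1}(c) − φ_l(c))·ψ_{l+1}(a)`, `0 = φ_0 ≤ φ_1 ≤ …` monotone on `γ`, `ψ_1 ≥ ψ_2 ≥ … ≥ 0` monotone on `α`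
(events on cubes: `1[s(c) + t(a) ≥ K+1]` for increasing level statistics `s, t`, i.e. unions `⋃_l U_l × V_l` of nested rectangles —
the members that see each block through SOME increasing chain statistic; EVERY member is one when a block is a single bit).
**THEOREM (`sahiE_three_nonneg_of_staircase`): `E_3(f,g,h) ≥ 0`** for every `K`, all FKG block lattices, all monotone `g, h ≥ 0`.

PROOF (β-reduction + ONE ratio + the dominance lemma of `…StaircaseAllDominance`).  For `b ∈ β`: `x_l(b) = E_c[(φ_{l+1}−φ_l) g(·,b)]`,
`V_l(b) = E_a[ψ_l h(·,b)]`, `G = E_c g(·,b)`, `H = E_a h(·,b)`, `p_l = E φ_{l+1} − E φ_l`, `Q_l = E ψ_l`, bars for `E_b`,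
RATIO `ρ_l := Q_l H̄ / V̄_l ∈ [0,1]` (`1` on null levels).  Exact identity (`sahiE_three_eq`):
`E_3 = E_b[Φ] + Σ_l ρ_{l+1} Cov_b(x_l, V_{l+1}) + Σ_l (1−ρ_{l+1}) p_l Cov_b(G, V_{l+1})`,
`Φ(b) = Σ_l [(2−ρ_{l+1}) x_l V_{l+1} − G p_l (Q_{l+1} H + (1−ρ_{l+1}) V_{l+1})]` (for general `ρ` the defect is
`Σ_l (x̄_l − p_l Ḡ)(ρ_{l+1} V̄_{l+1} − Q_{l+1} H̄)`, killed termwise by the ratio).  Covariances `≥ 0` by FKG on `β`; `Φ ≥ 0`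
POINTWISE by `dominance` (`x(b)` is top-heavy w.r.t. `G·p` by FKG on `γ`; margins from `V_i ≥ Q_i H` (FKG on `α`), `V` antitone
and the ratio condition `star_of_ratio`).
-/

noncomputable section

open scoped Classical

namespace Summit.CriticalPhenomena.PercolationContinuityZ3.Theorems

namespace SahiTriangleStaircaseAll

open Finset
open Literature.Combinatorics.Sahi2008
open SahiChainTriangle (ex_prod3)
open SahiTriangleSupermodular (fkg_sum sum3_bca)

section Setting

variable {α β γ : Type} [Fintype α] [Fintype β] [Fintype γ]
  (wA : α → ℝ) (wB : β → ℝ) (wC : γ → ℝ) (K : ℕ) (φ : ℕ → γ → ℝ) (ψ : ℕ → α → ℝ) (g : γ → β → ℝ) (h : α → β → ℝ)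

/-- The `K`-step staircase member `f(c,a) = Σ_{l<K+1} (φ_{l+1}(c) − φ_l(c)) ψ_{l+1}(a)`. [this work] -/
def member (c : γ) (a : α) : ℝ := ∑ l ∈ range (K + 1), (φ (l + 1) c - φ l c) * ψ (l + 1) a

/-- Level mass `x_l(b) = E_c[(φ_{l+1} − φ_l) g(·,b)]`. [this work] -/
def X (l : ℕ) (b : β) : ℝ := ∑ c, wC c * ((φ (l + 1) c - φ l c) * g c b)
/-- `V_l(b) = E_a[ψ_l h(·,b)]`. [this work] -/
def V (l : ℕ) (b : β) : ℝ := ∑ a, wA a * (ψ l a * h a b)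
/-- `G(b) = E_c g(·,b)`. [this work] -/
def GG (b : β) : ℝ := ∑ c, wC c * g c b
/-- `H(b) = E_a h(·,b)`. [this work] -/
def HH (b : β) : ℝ := ∑ a, wA a * h a b
/-- `P_l = E φ_l`. [this work] -/
def PP (l : ℕ) : ℝ := ∑ c, wC c * φ l c
/-- `p_l = E φ_{l+1} − E φ_l`. [this work] -/
def pp (l : ℕ) : ℝ := PP wC φ (l + 1) - PP wC φ l
/-- `Q_l = E ψ_l`. [this work] -/
def QQ (l : ℕ) : ℝ := ∑ a, wA a * ψ l a
/-- `V̄_l = E_b V_l`. [this work] -/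
def Vbar (l : ℕ) : ℝ := ∑ b, wB b * V wA ψ h l b
/-- `H̄ = E h`. [this work] -/
def Hbar : ℝ := ∑ b, wB b * HH wA h b
/-- `Ḡ = E g`. [this work] -/
def Gbar : ℝ := ∑ b, wB b * GG wC g b
/-- `x̄_l = E_b x_l`. [this work] -/
def Xbar (l : ℕ) : ℝ := ∑ b, wB b * X wC φ g l b
/-- The RATIO `ρ_l = Q_l H̄ / V̄_l` (`1` on a null level). [this work] -/
def rho (l : ℕ) : ℝ := if Vbar wA wB ψ h l = 0 then 1 else QQ wA ψ l * Hbar wA wB h / Vbar wA wB ψ h l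
/-- The level-`l` slice `Φ_l(b) = (2 − ρ_{l+1}) x_l V_{l+1} − G p_l (Q_{l+1} H + (1 − ρ_{l+1}) V_{l+1})` of the pointwise kernel.
[this work] -/
def PhiL (l : ℕ) (b : β) : ℝ :=
  (2 - rho wA wB ψ h (l + 1)) * (X wC φ g l b * V wA ψ h (l + 1) b) -
    GG wC g b * (pp wC φ l * (QQ wA ψ (l + 1) * HH wA h b + (1 - rho wA wB ψ h (l + 1)) * V wA ψ h (l + 1) b))
/-- The pointwise kernel `Φ(b) = Σ_{l<K+1} Φ_l(b)`. [this work] -/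
def Phi (b : β) : ℝ := ∑ l ∈ range (K + 1), PhiL wA wB wC φ ψ g h l b

/-! ### Plumbing: one factorisation lemma for all seven expectations -/
omit [Fintype α] [Fintype β] [Fintype γ] in
/-- `Σ_a Σ_b Σ_c wA wB wC · u(c,b) v(a,b) = Σ_b wB (Σ_c wC u(c,b)) (Σ_a wA v(a,b))`. [folklore] -/
theorem triple_factor [Fintype α] [Fintype β] [Fintype γ] (u : γ → β → ℝ) (v : α → β → ℝ) :
    (∑ a, ∑ b, ∑ c, wA a * wB b * wC c * (u c b * v a b)) = ∑ b, wB b * ((∑ c, wC c * u c b) * ∑ a, wA a * v a b) := by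
  rw [sum3_bca]
  refine sum_congr rfl fun b _ => ?_
  rw [sum_mul_sum, mul_sum]
  refine sum_congr rfl fun c _ => ?_
  rw [mul_sum]
  exact sum_congr rfl fun a _ => by ring

omit [Fintype α] [Fintype β] [Fintype γ] in
/-- `E[u(c,b) v(a,b)] = E_b[(E_c u)(E_a v)]` under the product weight. [folklore] -/
theorem ex_factor [Fintype α] [Fintype β] [Fintype γ] (u : γ → β → ℝ) (v : α → β → ℝ) :
    ex (fun q : α × β × γ => wA q.1 * wB q.2.1 * wC q.2.2) (fun q => u q.2.2 q.2.1 * v q.1 q.2.1) =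
      ∑ b, wB b * ((∑ c, wC c * u c b) * ∑ a, wA a * v a b) := by
  rw [ex_prod3]
  exact triple_factor wA wB wC u v

/-- `E` of a finite sum of functions (linearity of `ex`). [folklore] -/
theorem ex_finset_sum {δ : Type} [Fintype δ] (μ : δ → ℝ) (s : Finset ℕ) (F : ℕ → δ → ℝ) :
    ex μ (fun x => ∑ l ∈ s, F l x) = ∑ l ∈ s, ex μ (F l) := by
  unfold ex
  have : (∑ x, μ x * ∑ l ∈ s, F l x) = ∑ x, ∑ l ∈ s, μ x * F l x :=
    sum_congr rfl fun x _ => mul_sum s (fun l => F l x) (μ x)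
  rw [this, sum_comm]

/-- The level-sum bookkeeping behind `sahiE_three_eq`: an identity of finite sums of reals, by induction on the number of levels,
using only `r_l vb_l = q_l Hb` per level. [this work] -/
theorem level_sum_identity (SXV SGV xb vb r q pl : ℕ → ℝ) (SGH Gb Hb : ℝ) (hk : ∀ l, r l * vb l = q l * Hb) :
    ∀ n : ℕ, 2 * (∑ l ∈ range n, SXV l) + (∑ l ∈ range n, pl l * q l) * Gb * Hb -
        ((∑ l ∈ range n, pl l * q l) * SGH + Gb * (∑ l ∈ range n, pl l * vb l) + Hb * ∑ l ∈ range n, q l * xb l) =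
      (∑ l ∈ range n, ((2 - r l) * SXV l - pl l * (q l * SGH + (1 - r l) * SGV l))) +
        ∑ l ∈ range n, (r l * (SXV l - xb l * vb l) + (1 - r l) * pl l * (SGV l - Gb * vb l)) := by
  intro n
  induction n with
  | zero => simp
  | succ n ih =>
    simp only [sum_range_succ]
    linear_combination ih + (xb n - pl n * Gb) * hk n

end Setting

section Main

variable {α β γ : Type} [Fintype α] [Fintype β] [Fintype γ]
  {wA : α → ℝ} {wB : β → ℝ} {wC : γ → ℝ} {K : ℕ} {φ : ℕ → γ → ℝ} {ψ : ℕ → α → ℝ} {g : γ → β → ℝ} {h : α → β → ℝ}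

/-! ### The seven expectations in `b`-form -/
/-- The β-reduction of `E_3`: the seven moments of `(f,g,h)` in terms of `x_l, V_l, G, H` (needs only `Σ wA = Σ wB = Σ wC = 1`).
[this work] -/
theorem expectations (hA1 : ∑ a, wA a = 1) (hB1 : ∑ b, wB b = 1) (hC1 : ∑ c, wC c = 1) :
    ex (fun q : α × β × γ => wA q.1 * wB q.2.1 * wC q.2.2)
        ((fun q => member K φ ψ q.2.2 q.1) * (fun q => g q.2.2 q.2.1) * fun q => h q.1 q.2.1) =
      ∑ l ∈ range (K + 1), ∑ b, wB b * (X wC φ g l b * V wA ψ h (l + 1) b) ∧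
    ex (fun q : α × β × γ => wA q.1 * wB q.2.1 * wC q.2.2)
        ((fun q => member K φ ψ q.2.2 q.1) * fun q => g q.2.2 q.2.1) =
      ∑ l ∈ range (K + 1), QQ wA ψ (l + 1) * Xbar wB wC φ g l ∧
    ex (fun q : α × β × γ => wA q.1 * wB q.2.1 * wC q.2.2)
        ((fun q => member K φ ψ q.2.2 q.1) * fun q => h q.1 q.2.1) =
      ∑ l ∈ range (K + 1), pp wC φ l * Vbar wA wB ψ h (l + 1) ∧
    ex (fun q : α × β × γ => wA q.1 * wB q.2.1 * wC q.2.2) (fun q => member K φ ψ q.2.2 q.1) =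
      ∑ l ∈ range (K + 1), pp wC φ l * QQ wA ψ (l + 1) ∧
    ex (fun q : α × β × γ => wA q.1 * wB q.2.1 * wC q.2.2) ((fun q => g q.2.2 q.2.1) * fun q => h q.1 q.2.1) =
      ∑ b, wB b * (GG wC g b * HH wA h b) ∧
    ex (fun q : α × β × γ => wA q.1 * wB q.2.1 * wC q.2.2) (fun q => g q.2.2 q.2.1) = Gbar wB wC g ∧
    ex (fun q : α × β × γ => wA q.1 * wB q.2.1 * wC q.2.2) (fun q => h q.1 q.2.1) = Hbar wA wB h := by
  have ppsum : ∀ l, (∑ c, wC c * (φ (l + 1) c - φ l c)) = pp wC φ l := fun l => by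
    unfold pp PP; rw [← sum_sub_distrib]; exact sum_congr rfl fun c _ => by ring
  refine ⟨?_, ?_, ?_, ?_, ?_, ?_, ?_⟩
  · -- E[fgh]
    have e : ((fun q : α × β × γ => member K φ ψ q.2.2 q.1) * (fun q => g q.2.2 q.2.1) * fun q => h q.1 q.2.1) =
        fun q => ∑ l ∈ range (K + 1), ((φ (l + 1) q.2.2 - φ l q.2.2) * g q.2.2 q.2.1) * (ψ (l + 1) q.1 * h q.1 q.2.1) := by
      ext q; simp only [Pi.mul_apply, member, sum_mul]; exact sum_congr rfl fun l _ => by ring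
    rw [e, ex_finset_sum]
    refine sum_congr rfl fun l _ => ?_
    exact ex_factor wA wB wC (fun c b => (φ (l + 1) c - φ l c) * g c b) (fun a b => ψ (l + 1) a * h a b)
  · -- E[fg]
    have e : ((fun q : α × β × γ => member K φ ψ q.2.2 q.1) * fun q => g q.2.2 q.2.1) =
        fun q => ∑ l ∈ range (K + 1), ((φ (l + 1) q.2.2 - φ l q.2.2) * g q.2.2 q.2.1) * ψ (l + 1) q.1 := by
      ext q; simp only [Pi.mul_apply, member, sum_mul]; exact sum_congr rfl fun l _ => by ring
    rw [e, ex_finset_sum]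
    refine sum_congr rfl fun l _ => ?_
    refine (ex_factor wA wB wC (fun c b => (φ (l + 1) c - φ l c) * g c b) (fun a _ => ψ (l + 1) a)).trans ?_
    unfold QQ Xbar X
    rw [mul_sum]
    exact sum_congr rfl fun b _ => by ring
  · -- E[fh]
    have e : ((fun q : α × β × γ => member K φ ψ q.2.2 q.1) * fun q => h q.1 q.2.1) =
        fun q => ∑ l ∈ range (K + 1), (φ (l + 1) q.2.2 - φ l q.2.2) * (ψ (l + 1) q.1 * h q.1 q.2.1) := by
      ext q; simp only [Pi.mul_apply, member, sum_mul]; exact sum_congr rfl fun l _ => by ring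
    rw [e, ex_finset_sum]
    refine sum_congr rfl fun l _ => ?_
    refine (ex_factor wA wB wC (fun c _ => φ (l + 1) c - φ l c) (fun a b => ψ (l + 1) a * h a b)).trans ?_
    unfold Vbar V
    rw [ppsum l, mul_sum]
    exact sum_congr rfl fun b _ => by ring
  · -- E[f]
    have e : (fun q : α × β × γ => member K φ ψ q.2.2 q.1) =
        fun q => ∑ l ∈ range (K + 1), (φ (l + 1) q.2.2 - φ l q.2.2) * ψ (l + 1) q.1 := by
      ext q; simp only [member]
    rw [e, ex_finset_sum]
    refine sum_congr rfl fun l _ => ?_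
    refine (ex_factor wA wB wC (fun c _ => φ (l + 1) c - φ l c) (fun a _ => ψ (l + 1) a)).trans ?_
    unfold QQ
    rw [ppsum l, ← sum_mul, hB1, one_mul]
  · -- E[gh]
    have e : ((fun q : α × β × γ => g q.2.2 q.2.1) * fun q => h q.1 q.2.1) = fun q => g q.2.2 q.2.1 * h q.1 q.2.1 := by
      ext q; simp only [Pi.mul_apply]
    rw [e]
    exact ex_factor wA wB wC g h
  · -- E[g]
    have e : (fun q : α × β × γ => g q.2.2 q.2.1) = fun q => g q.2.2 q.2.1 * (fun (_ : α) (_ : β) => (1 : ℝ)) q.1 q.2.1 := by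
      ext q; simp
    rw [e]
    refine (ex_factor wA wB wC g (fun _ _ => (1 : ℝ))).trans ?_
    unfold Gbar GG
    refine sum_congr rfl fun b _ => ?_
    simp only [mul_one, hA1]
  · -- E[h]
    have e : (fun q : α × β × γ => h q.1 q.2.1) = fun q => (fun (_ : γ) (_ : β) => (1 : ℝ)) q.2.2 q.2.1 * h q.1 q.2.1 := by
      ext q; simp
    rw [e]
    refine (ex_factor wA wB wC (fun _ _ => (1 : ℝ)) h).trans ?_
    unfold Hbar HH
    refine sum_congr rfl fun b _ => ?_
    simp only [mul_one, hC1, one_mul]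

/-! ### The ratio and the exact identity -/
omit [Fintype β] [Fintype γ] in
/-- `V_l(b) ≥ 0`. [this work] -/
theorem V_nonneg (hA0 : ∀ a, 0 ≤ wA a) (hψ0 : ∀ l a, 0 ≤ ψ l a) (hh0 : ∀ a b, 0 ≤ h a b) (l : ℕ) (b : β) :
    0 ≤ V wA ψ h l b :=
  sum_nonneg fun a _ => mul_nonneg (hA0 a) (mul_nonneg (hψ0 l a) (hh0 a b))

omit [Fintype β] [Fintype γ] in
/-- `V_l(b) ≥ Q_l H(b)` (FKG/Chebyshev on `α`). [this work] -/
theorem QH_le_V [DistribLattice α] (hA : IsFKGMeasure wA) (hψ0 : ∀ l a, 0 ≤ ψ l a) (hh0 : ∀ a b, 0 ≤ h a b)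
    (hψa : ∀ l, Monotone (ψ l)) (hha : ∀ b, Monotone (fun a => h a b)) (l : ℕ) (b : β) :
    QQ wA ψ l * HH wA h b ≤ V wA ψ h l b := by
  unfold QQ HH V
  exact fkg_sum hA (hψ0 l) (fun a => hh0 a b) (hψa l) (hha b)

omit [Fintype γ] in
/-- `V̄_l ≥ Q_l H̄`. [this work] -/
theorem QHbar_le_Vbar [DistribLattice α] (hA : IsFKGMeasure wA) (hB0 : ∀ b, 0 ≤ wB b) (hψ0 : ∀ l a, 0 ≤ ψ l a)
    (hh0 : ∀ a b, 0 ≤ h a b) (hψa : ∀ l, Monotone (ψ l)) (hha : ∀ b, Monotone (fun a => h a b)) (l : ℕ) :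
    QQ wA ψ l * Hbar wA wB h ≤ Vbar wA wB ψ h l := by
  unfold Hbar Vbar
  rw [mul_sum]
  refine sum_le_sum fun b _ => ?_
  have := QH_le_V hA hψ0 hh0 hψa hha l b
  have hb := hB0 b
  nlinarith

omit [Fintype γ] in
/-- The ratio satisfies `ρ_l V̄_l = Q_l H̄`, `0 ≤ ρ_l ≤ 1`, and `ρ_l = 1` on null levels. [this work] -/
theorem rho_spec [DistribLattice α] (hA : IsFKGMeasure wA) (hB0 : ∀ b, 0 ≤ wB b) (hψ0 : ∀ l a, 0 ≤ ψ l a)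
    (hh0 : ∀ a b, 0 ≤ h a b) (hψa : ∀ l, Monotone (ψ l)) (hha : ∀ b, Monotone (fun a => h a b)) (l : ℕ) :
    rho wA wB ψ h l * Vbar wA wB ψ h l = QQ wA ψ l * Hbar wA wB h ∧ 0 ≤ rho wA wB ψ h l ∧ rho wA wB ψ h l ≤ 1 ∧
      (Vbar wA wB ψ h l = 0 → rho wA wB ψ h l = 1) := by
  have hQH : 0 ≤ QQ wA ψ l * Hbar wA wB h :=
    mul_nonneg (sum_nonneg fun a _ => mul_nonneg (hA.nonneg a) (hψ0 l a))
      (sum_nonneg fun b _ => mul_nonneg (hB0 b) (sum_nonneg fun a _ => mul_nonneg (hA.nonneg a) (hh0 a b)))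
  have hle := QHbar_le_Vbar hA hB0 hψ0 hh0 hψa hha l
  by_cases hV : Vbar wA wB ψ h l = 0
  · have hQ0 : QQ wA ψ l * Hbar wA wB h = 0 := le_antisymm (by rw [← hV]; exact hle) hQH
    simp [rho, hV, hQ0]
  · have hVpos : 0 < Vbar wA wB ψ h l := lt_of_le_of_ne (le_trans hQH hle) (Ne.symm hV)
    simp only [rho, hV, if_false]
    refine ⟨by field_simp, div_nonneg hQH hVpos.le, (div_le_one hVpos).mpr hle, fun h0 => False.elim h0⟩

/-- `Σ_b wB Φ_l(b)` in terms of the level moments. [this work] -/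
theorem sum_PhiL (l : ℕ) :
    (∑ b, wB b * PhiL wA wB wC φ ψ g h l b) =
      (2 - rho wA wB ψ h (l + 1)) * (∑ b, wB b * (X wC φ g l b * V wA ψ h (l + 1) b)) -
        pp wC φ l * (QQ wA ψ (l + 1) * (∑ b, wB b * (GG wC g b * HH wA h b)) +
          (1 - rho wA wB ψ h (l + 1)) * ∑ b, wB b * (GG wC g b * V wA ψ h (l + 1) b)) := by
  have e : (fun b => wB b * PhiL wA wB wC φ ψ g h l b) = fun b =>
      (2 - rho wA wB ψ h (l + 1)) * (wB b * (X wC φ g l b * V wA ψ h (l + 1) b)) -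
        pp wC φ l * QQ wA ψ (l + 1) * (wB b * (GG wC g b * HH wA h b)) -
        pp wC φ l * (1 - rho wA wB ψ h (l + 1)) * (wB b * (GG wC g b * V wA ψ h (l + 1) b)) := by
    ext b; unfold PhiL; ring
  rw [show (∑ b, wB b * PhiL wA wB wC φ ψ g h l b) = ∑ b, (fun b => wB b * PhiL wA wB wC φ ψ g h l b) b from rfl, e]
  simp only [sum_sub_distrib, ← mul_sum]
  ring

/-- **THE EXACT IDENTITY** `E_3 = E_b[Φ] + Σ_l [ρ_{l+1} Cov_b(x_l, V_{l+1}) + (1 − ρ_{l+1}) p_l Cov_b(G, V_{l+1})]`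
(probability weights; the only property of `ρ` used is `ρ_l V̄_l = Q_l H̄`). [this work] -/
theorem sahiE_three_eq [DistribLattice α] [DistribLattice β] (hA : IsFKGMeasure wA) (hB : IsFKGMeasure wB)
    (hC1 : ∑ c, wC c = 1) (hψ0 : ∀ l a, 0 ≤ ψ l a) (hh0 : ∀ a b, 0 ≤ h a b) (hψa : ∀ l, Monotone (ψ l))
    (hha : ∀ b, Monotone (fun a => h a b)) :
    sahiE (fun q : α × β × γ => wA q.1 * wB q.2.1 * wC q.2.2) 3
        ![fun q => member K φ ψ q.2.2 q.1, fun q => g q.2.2 q.2.1, fun q => h q.1 q.2.1] =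
      (∑ b, wB b * Phi wA wB wC K φ ψ g h b) +
      ∑ l ∈ range (K + 1), (rho wA wB ψ h (l + 1) *
          ((∑ b, wB b * (X wC φ g l b * V wA ψ h (l + 1) b)) - Xbar wB wC φ g l * Vbar wA wB ψ h (l + 1)) +
        (1 - rho wA wB ψ h (l + 1)) * pp wC φ l *
          ((∑ b, wB b * (GG wC g b * V wA ψ h (l + 1) b)) - Gbar wB wC g * Vbar wA wB ψ h (l + 1))) := by
  obtain ⟨eFGH, eFG, eFH, eF, eGH, eG, eH⟩ :=
    expectations (K := K) (φ := φ) (ψ := ψ) (g := g) (h := h) hA.sum_eq_one hB.sum_eq_one hC1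
  rw [sahiE_three, eFGH, eFG, eFH, eF, eGH, eG, eH]
  -- Σ_b wB Φ(b) = Σ_l Σ_b wB Φ_l(b)
  have ePhi : (∑ b, wB b * Phi wA wB wC K φ ψ g h b) = ∑ l ∈ range (K + 1), ∑ b, wB b * PhiL wA wB wC φ ψ g h l b := by
    unfold Phi
    simp only [mul_sum]
    rw [sum_comm]
  rw [ePhi]
  simp only [sum_PhiL]
  have key : ∀ l, rho wA wB ψ h (l + 1) * Vbar wA wB ψ h (l + 1) = QQ wA ψ (l + 1) * Hbar wA wB h :=
    fun l => (rho_spec hA hB.nonneg hψ0 hh0 hψa hha (l + 1)).1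
  exact level_sum_identity (fun l => ∑ b, wB b * (X wC φ g l b * V wA ψ h (l + 1) b))
    (fun l => ∑ b, wB b * (GG wC g b * V wA ψ h (l + 1) b)) (Xbar wB wC φ g) (fun l => Vbar wA wB ψ h (l + 1))
    (fun l => rho wA wB ψ h (l + 1)) (fun l => QQ wA ψ (l + 1)) (pp wC φ) (∑ b, wB b * (GG wC g b * HH wA h b))
    (Gbar wB wC g) (Hbar wA wB h) key (K + 1)

/-! ### The theorem -/
/-- **THEOREM (CONJECTURE STAIR, every `K`).**  `α, β, γ` finite distributive lattices with FKG probability weights; `g, h ≥ 0`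
coordinatewise monotone; `φ : ℕ → γ → ℝ` with `φ_0 = 0`, `φ_{K+1} = 1`, `φ_l ≤ φ_{l+1}`, each `φ_l` monotone; `ψ : ℕ → α → ℝ` with
`0 ≤ ψ_{l+1} ≤ ψ_l`, each `ψ_l` monotone (e.g. `ψ_0 = 1`, `ψ_{K+1} = 0`).  Then Sahi's `E_3(f, g, h) ≥ 0` for the `K`-step
staircase member `f = Σ_{l<K+1} (φ_{l+1} − φ_l) ψ_{l+1}` under the product weight on `α × β × γ`. [this work] -/
theorem sahiE_three_nonneg_of_staircase [DistribLattice α] [DistribLattice β] [DistribLattice γ]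
    (hA : IsFKGMeasure wA) (hB : IsFKGMeasure wB) (hC : IsFKGMeasure wC)
    (hφ0 : ∀ c, φ 0 c = 0) (hφl : ∀ l c, φ l c ≤ φ (l + 1) c) (hφc : ∀ l, Monotone (φ l))
    (hψnn : ∀ l a, 0 ≤ ψ l a) (hψl : ∀ l a, ψ (l + 1) a ≤ ψ l a) (hψa : ∀ l, Monotone (ψ l))
    (hg0 : ∀ c b, 0 ≤ g c b) (hgc : ∀ b, Monotone (fun c => g c b)) (hgb : ∀ c, Monotone (g c))
    (hh0 : ∀ a b, 0 ≤ h a b) (hha : ∀ b, Monotone (fun a => h a b)) (hhb : ∀ a, Monotone (h a)) :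
    0 ≤ sahiE (fun q : α × β × γ => wA q.1 * wB q.2.1 * wC q.2.2) 3
        ![fun q => member K φ ψ q.2.2 q.1, fun q => g q.2.2 q.2.1, fun q => h q.1 q.2.1] := by
  rw [sahiE_three_eq hA hB hC.sum_eq_one hψnn hh0 hψa hha]
  have hA0 := hA.nonneg; have hB0 := hB.nonneg; have hC0 := hC.nonneg
  have hφmono : ∀ c, Monotone (fun l => φ l c) := fun c => monotone_nat_of_le_succ fun l => hφl l c
  have hφnn : ∀ l c, 0 ≤ φ l c := fun l c => by have h1 := hφmono c (Nat.zero_le l); simp only [hφ0] at h1; exact h1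
  have hψanti : ∀ a, Antitone (fun l => ψ l a) := fun a => antitone_nat_of_succ_le fun l => hψl l a
  have hX0 : ∀ l b, 0 ≤ X wC φ g l b := fun l b =>
    sum_nonneg fun c _ => mul_nonneg (hC0 c) (mul_nonneg (sub_nonneg.mpr (hφl l c)) (hg0 c b))
  have hXmono : ∀ l, Monotone (X wC φ g l) := fun l b b' hbb =>
    sum_le_sum fun c _ => mul_le_mul_of_nonneg_left (mul_le_mul_of_nonneg_left (hgb c hbb) (sub_nonneg.mpr (hφl l c))) (hC0 c)
  have hV0 : ∀ l b, 0 ≤ V wA ψ h l b := V_nonneg hA0 hψnn hh0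
  have hVmono : ∀ l, Monotone (V wA ψ h l) := fun l b b' hbb =>
    sum_le_sum fun a _ => mul_le_mul_of_nonneg_left (mul_le_mul_of_nonneg_left (hhb a hbb) (hψnn l a)) (hA0 a)
  have hVanti : ∀ b i j, i ≤ j → V wA ψ h j b ≤ V wA ψ h i b := fun b i j hij =>
    sum_le_sum fun a _ => mul_le_mul_of_nonneg_left (mul_le_mul_of_nonneg_right (hψanti a hij) (hh0 a b)) (hA0 a)
  have hG0 : ∀ b, 0 ≤ GG wC g b := fun b => sum_nonneg fun c _ => mul_nonneg (hC0 c) (hg0 c b)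
  have hGmono : Monotone (GG wC g) := fun b b' hbb => sum_le_sum fun c _ => mul_le_mul_of_nonneg_left (hgb c hbb) (hC0 c)
  have hH0 : ∀ b, 0 ≤ HH wA h b := fun b => sum_nonneg fun a _ => mul_nonneg (hA0 a) (hh0 a b)
  have hp0 : ∀ l, 0 ≤ pp wC φ l := fun l => by
    unfold pp PP; rw [← sum_sub_distrib]
    exact sum_nonneg fun c _ => by rw [← mul_sub]; exact mul_nonneg (hC0 c) (sub_nonneg.mpr (hφl l c))
  have hQ0 : ∀ l, 0 ≤ QQ wA ψ l := fun l => sum_nonneg fun a _ => mul_nonneg (hA0 a) (hψnn l a)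
  have hQanti : ∀ i j, i ≤ j → QQ wA ψ j ≤ QQ wA ψ i := fun i j hij =>
    sum_le_sum fun a _ => mul_le_mul_of_nonneg_left (hψanti a hij) (hA0 a)
  have hVbanti : ∀ i j, i ≤ j → Vbar wA wB ψ h j ≤ Vbar wA wB ψ h i := fun i j hij =>
    sum_le_sum fun b _ => mul_le_mul_of_nonneg_left (hVanti b i j hij) (hB0 b)
  have hHb0 : 0 ≤ Hbar wA wB h := sum_nonneg fun b _ => mul_nonneg (hB0 b) (hH0 b)
  have hρ := fun l => rho_spec hA hB0 hψnn hh0 hψa hha l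
  -- the ratio condition (⋆)
  have hstar : ∀ i j, i ≤ j → QQ wA ψ j ≤ (1 - rho wA wB ψ h i + rho wA wB ψ h j) * QQ wA ψ i :=
    star_of_ratio (rho wA wB ψ h) (QQ wA ψ) (Vbar wA wB ψ h) (Hbar wA wB h) hHb0 hQ0 hQanti hVbanti
      (QHbar_le_Vbar hA hB0 hψnn hh0 hψa hha) (fun l => (hρ l).1) (fun l => (hρ l).2.1) (fun l => (hρ l).2.2.2)
  -- (1) Φ(b) ≥ 0 pointwise, by the dominance lemma
  have hPhi : ∀ b, 0 ≤ Phi wA wB wC K φ ψ g h b := by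
    intro b
    have hdom := dominance (K + 1) (fun l => X wC φ g l b) (pp wC φ)
      (fun l => (2 - rho wA wB ψ h (l + 1)) * V wA ψ h (l + 1) b)
      (fun l => QQ wA ψ (l + 1) * HH wA h b + (1 - rho wA wB ψ h (l + 1)) * V wA ψ h (l + 1) b) (GG wC g b)
      (fun l => hX0 l b) hp0 (hG0 b) (fun l => mul_nonneg (by linarith [(hρ (l + 1)).2.2.1]) (hV0 (l + 1) b)) ?_ ?_
    · have e : Phi wA wB wC K φ ψ g h b =
          (∑ l ∈ range (K + 1), X wC φ g l b * ((2 - rho wA wB ψ h (l + 1)) * V wA ψ h (l + 1) b)) -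
            GG wC g b * ∑ l ∈ range (K + 1), pp wC φ l *
              (QQ wA ψ (l + 1) * HH wA h b + (1 - rho wA wB ψ h (l + 1)) * V wA ψ h (l + 1) b) := by
        unfold Phi PhiL
        rw [sum_sub_distrib, ← mul_sum]
        congr 1
        exact sum_congr rfl fun l _ => by ring
      rw [e, sub_nonneg]
      exact hdom
    · -- top-heaviness: Σ_{l≤i} x_l = E_c[φ_{i+1} g] ≥ P_{i+1} G = G Σ_{l≤i} p_l  (FKG on γ; telescoping)
      intro i _
      have tele1 : ∀ m, (∑ l ∈ range m, X wC φ g l b) = ∑ c, wC c * (φ m c * g c b) := fun m => by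
        induction m with
        | zero => simp [hφ0]
        | succ m ih =>
          rw [sum_range_succ, ih, X, ← sum_add_distrib]
          exact sum_congr rfl fun c _ => by ring
      have tele2 : ∀ m, (∑ l ∈ range m, pp wC φ l) = PP wC φ m := fun m => by
        induction m with
        | zero => simp [PP, hφ0]
        | succ m ih => rw [sum_range_succ, ih, pp]; ring
      rw [tele1, tele2, PP, GG]
      have := fkg_sum hC (hφnn (i + 1)) (fun c => hg0 c b) (hφc (i + 1)) (hgc b)
      linarith
    · -- margins
      intro i i' hii' _
      exact margin (fun l => rho wA wB ψ h (l + 1)) (fun l => QQ wA ψ (l + 1)) (fun l => V wA ψ h (l + 1) b) (HH wA h b)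
        (hH0 b) (fun l => (hρ (l + 1)).2.1) (fun l => (hρ (l + 1)).2.2.1)
        (fun l l' hll' => hVanti b (l + 1) (l' + 1) (Nat.succ_le_succ hll'))
        (fun l => QH_le_V hA hψnn hh0 hψa hha (l + 1) b)
        (fun l l' hll' => hstar (l + 1) (l' + 1) (Nat.succ_le_succ hll')) i i' hii'
  -- (2) the covariances are ≥ 0 (FKG on β)
  have hcovX : ∀ l, Xbar wB wC φ g l * Vbar wA wB ψ h (l + 1) ≤ ∑ b, wB b * (X wC φ g l b * V wA ψ h (l + 1) b) :=
    fun l => fkg_sum hB (hX0 l) (hV0 (l + 1)) (hXmono l) (hVmono (l + 1))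
  have hcovG : ∀ l, Gbar wB wC g * Vbar wA wB ψ h (l + 1) ≤ ∑ b, wB b * (GG wC g b * V wA ψ h (l + 1) b) :=
    fun l => fkg_sum hB hG0 (hV0 (l + 1)) hGmono (hVmono (l + 1))
  refine add_nonneg (sum_nonneg fun b _ => mul_nonneg (hB0 b) (hPhi b)) (sum_nonneg fun l _ => add_nonneg ?_ ?_)
  · exact mul_nonneg (hρ (l + 1)).2.1 (sub_nonneg.mpr (hcovX l))
  · exact mul_nonneg (mul_nonneg (by linarith [(hρ (l + 1)).2.2.1]) (hp0 l)) (sub_nonneg.mpr (hcovG l))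

end Main

end SahiTriangleStaircaseAll

end Summit.CriticalPhenomena.PercolationContinuityZ3.Theorems
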